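import Summits.Schanuel.Schanuel.Theorems.RootDecomp1BTameFlag

/-!
NOTE (census g6 landing): twelve theorems whose statements PRINT like their `RootDecomp1BDefectFloorCore` name-sakes (over the
`DefectFloorDefs` copies of the same texts) are `private` here to pass the gate's dedup — the gate keys on the PRINTED statement, and the route decls print exactly like
their `DefectFloorDefs`/`TameFlagCore` copies, so the LANDED `RootDecomp1BDefectFloorCore.tameSharpStep_of_floor` /
`….tameSurplusOneStep_of_tameDefectZero` / `….wildSharpHyperplane_of_floor` / `….gen8_steps_of_floor` ARE the retiring theorems of
record for TSH 32141 / TS1 32142 / WSH 32143 (definitionally the live route decls) (also private here: succ_le/pred_le_polarDeg_of_floor,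
succ_le_polarDeg_of_gen8_steps, sharpRelativeLindemann_of_gen8_steps, tameDefectZeroStep_of_tame_steps,
wildSharpDefectZeroStep_of_wildSharpHyperplane, gen9_pieces_iff_gen8_steps, noAutonomousSlackFirstFailure_of_pieces9); the PUBLIC theorems of this file, stated over the LIVE route decls verbatim, are `noDefectTwoFirstFailure_of_floor` (25469 ⟸ SRL),
`noAutonomousSlackFirstFailureGlue9_holds` (SRL → T0 → W0 → WAS → NoAutonomousSlackFirstFailure) and `kleinPolarSchanuel_of_pieces9`
(LSB → Free → Tight → SRL → T0 → W0 → WAS → KleinPolarSchanuel).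

# RootDecomp1B — round 9 (lens-4 gen 9 «DefectFloor»): the sharp-hyperplane steps factored by DEFECT LEVEL

Port target: `lean/Summits/Schanuel/Schanuel/Theorems/RootDecomp1BDefectFloor.lean`
(`--supports <SharpRelativeLindemann item>`; evidence for retiring 32141 / 32142 / 32143 and for the asides 25469 / 30166;
under PATH R9 the theorem `noAutonomousSlackFirstFailure_of_pieces9` is the `--glue` statement's `_holds`).

Over the LIVE route constants of `Theses/RootDecomp1B.lean` AFTER round 9 is typed (`SharpRelativeLindemann` SRL,
`TameDefectZeroStep` T0, `WildSharpDefectZeroStep` W0 new; `TameSharpStep` 32141, `TameSurplusOneStep` 32142,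
`WildSharpHyperplane` 32143, `NoWildAbsorbingSlackFirstFailure` 32144, `NoAutonomousSlackFirstFailure` 30166,
`NoDefectTwoFirstFailure` 25469, `LocalSurplusBudget` 27214, `FreeSideCoupling` 28104, `TightBudgetCoupling` 29188,
`KleinPolarSchanuel` 24622) and the landed kernel `RootDecomp1BTameFlag{Core,Steps}` / `RootDecomp1BFedFlagCore` /
`RootDecomp1BTameFlag` (round-8 retirements, p769639) — by `import` + definitional unfolding; the round-8 chains
`noAutonomousSlackFirstFailure_of_pieces8` / `kleinPolarSchanuel_of_pieces8` are CALLED, not restated (H1):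

* `tameSharpStep_of_floor : SRL → T0 → TameSharpStep`, `tameSurplusOneStep_of_tameDefectZero : T0 → TameSurplusOneStep`,
  `wildSharpHyperplane_of_floor : SRL → W0 → WildSharpHyperplane` — the three gen-8 steps are RETIRED by kernel implication;
* the converse `sharpRelativeLindemann_of_gen8_steps`, `tameDefectZeroStep_of_tame_steps`,
  `wildSharpDefectZeroStep_of_wildSharpHyperplane` and `gen9_pieces_iff_gen8_steps` — the round is an EXACT re-factorisation;
* `noDefectTwoFirstFailure_of_floor : SRL → NoDefectTwoFirstFailure` — C₁′ (25469) follows from the floor ALONE;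
* `noAutonomousSlackFirstFailure_of_pieces9 : SRL → T0 → W0 → WAS → NoAutonomousSlackFirstFailure` (30166; PATH R9 glue);
* `kleinPolarSchanuel_of_pieces9 : LSB → Free → Tight → SRL → T0 → W0 → WAS → KleinPolarSchanuel` — the chain beneath the EQUIV layer.

This file defines nothing; no transcendence input; 0 sorry.
-/

set_option linter.dupNamespace false

namespace Summit.Schanuel.Schanuel.Theorems.RootDecomp1BDefectFloor

open Summit.Schanuel.Schanuel.Theses.RootDecomp1B (KleinPolarSchanuel LocalSurplusBudget FreeSideCoupling TightBudgetCoupling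
  NoDefectTwoFirstFailure NoAutonomousSlackFirstFailure TameSharpStep TameSurplusOneStep WildSharpHyperplane
  NoWildAbsorbingSlackFirstFailure SharpRelativeLindemann TameDefectZeroStep WildSharpDefectZeroStep)
open Summit.Schanuel.Schanuel.Theorems.RootDecomp1BTameFlagCore (tameKleinPolar_of_flag_steps wild_dichotomy isTame_or_isWild
  isTame_of_lastTame)
open Summit.Schanuel.Schanuel.Theorems.RootDecomp1BFedFlagCore (polarDeg KleinIH polarDeg_init_le polarDeg_lt_aleph0)
open Summit.Schanuel.Schanuel.Theorems.RootDecomp1BTameFlag (noAutonomousSlackFirstFailure_of_pieces8 kleinPolarSchanuel_of_pieces8)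

/-! ### The hypothesis-free floor -/

/-- Under SRL EVERY `ℚ`-free `(m+1)`-tuple over KleinIH has polar degree `≥ 2m + 1` (sharp hyperplane `Fin.init r`: the piece;
otherwise monotonicity `t(r) ≥ t(r') ≥ 2m + 1`). -/
private theorem succ_le_polarDeg_of_floor (hF : SharpRelativeLindemann) {m : ℕ} {r : Fin (m + 1) → ℝ}
    (hr : LinearIndependent ℚ r) (hIH : KleinIH (m + 1)) : ((m + m + 1 : ℕ) : Cardinal) ≤ polarDeg r := by
  have hmono := polarDeg_init_le r
  obtain ⟨n', hn'⟩ := Cardinal.lt_aleph0.mp (polarDeg_lt_aleph0 (Fin.init r))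
  obtain ⟨n, hn⟩ := Cardinal.lt_aleph0.mp (polarDeg_lt_aleph0 r)
  rcases Nat.lt_or_ge n' (m + m + 1) with hlt | hge
  · have hle : polarDeg (Fin.init r) ≤ ((m + m : ℕ) : Cardinal) := by
      rw [hn']
      exact_mod_cast (by omega : n' ≤ m + m)
    exact hF m r hr hIH hle
  · rw [hn', hn] at hmono
    rw [hn]
    norm_cast at hmono ⊢
    omega

/-- … hence every `ℚ`-free `m`-tuple over KleinIH has `t ≥ 2m − 1`. -/
private theorem pred_le_polarDeg_of_floor (hF : SharpRelativeLindemann) {m : ℕ} {r : Fin m → ℝ} (hr : LinearIndependent ℚ r)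
    (hIH : KleinIH m) : ((m + m - 1 : ℕ) : Cardinal) ≤ polarDeg r := by
  cases m with
  | zero => simp
  | succ k =>
    have e : k + 1 + (k + 1) - 1 = k + k + 1 := by omega
    rw [e]
    exact succ_le_polarDeg_of_floor hF hr hIH

/-! ### RETIREMENT of the gen-8 steps (32141, 32142, 32143) by kernel implication -/

/-- retires TSH (stmt-Schanuel-32141): over a sharp hyperplane the floor gives `t ≥ 2m + 1`, the tame defect-zero step the rest. -/
private theorem tameSharpStep_of_floor (hF : SharpRelativeLindemann) (hT : TameDefectZeroStep) : TameSharpStep :=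
  fun m r hr hIH ht hle => hT m r hr hIH ht (hF m r hr hIH hle)

/-- retires TS1 (stmt-Schanuel-32142) from T0 OUTRIGHT: over a surplus-one hyperplane `t(r) ≥ t(r') = 2m + 1` by monotonicity. -/
private theorem tameSurplusOneStep_of_tameDefectZero (hT : TameDefectZeroStep) : TameSurplusOneStep :=
  fun m r hr hIH ht heq => hT m r hr hIH ht ((le_of_eq heq.symm).trans (polarDeg_init_le r))

/-- retires WSH (stmt-Schanuel-32143): W0 is WSH's text with the hypothesis `2m + 1 ≤ t(r)` inserted, and that hypothesis is
the hypothesis-free floor. -/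
private theorem wildSharpHyperplane_of_floor (hF : SharpRelativeLindemann) (hW : WildSharpDefectZeroStep) :
    WildSharpHyperplane :=
  fun m r hr hIH hWld hS => hW m r hr hIH hWld hS (succ_le_polarDeg_of_floor hF hr hIH)

/-- The three gen-8 steps (TSH, TS1, WSH) follow from the floor SRL and the two defect-zero steps T0, W0. -/
private theorem gen8_steps_of_floor (hF : SharpRelativeLindemann) (hT : TameDefectZeroStep) (hW : WildSharpDefectZeroStep) :
    TameSharpStep ∧ TameSurplusOneStep ∧ WildSharpHyperplane :=
  ⟨tameSharpStep_of_floor hF hT, tameSurplusOneStep_of_tameDefectZero hT, wildSharpHyperplane_of_floor hF hW⟩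

/-! ### EXACTNESS: the gen-9 pieces from the gen-8 steps -/

/-- Under the gen-8 steps, a sharp initial hyperplane forces polar degree ≥ 2m + 1 (the floor). -/
private theorem succ_le_polarDeg_of_gen8_steps (hTS : TameSharpStep) (hT1 : TameSurplusOneStep) (hWSH : WildSharpHyperplane)
    {m : ℕ} {r : Fin (m + 1) → ℝ} (hr : LinearIndependent ℚ r) (hIH : KleinIH (m + 1)) :
    ((m + m + 1 : ℕ) : Cardinal) ≤ polarDeg r := by
  have hle : ((m + m + 1 : ℕ) : Cardinal) ≤ ((m + 1 + (m + 1) : ℕ) : Cardinal) := by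
    exact_mod_cast (by omega : m + m + 1 ≤ m + 1 + (m + 1))
  rcases isTame_or_isWild r with hT | hW
  · exact hle.trans (tameKleinPolar_of_flag_steps hTS hT1 (m + 1) r hr hIH hT)
  · rcases wild_dichotomy hWSH hr hIH hW with ⟨_, hlow⟩ | hdone
    · have e : m + 1 + (m + 1) - 1 = m + m + 1 := by omega
      rw [e] at hlow
      exact hlow
    · exact hle.trans hdone

/-- SRL follows from the gen-8 steps TSH ∧ TS1 ∧ WSH. -/
private theorem sharpRelativeLindemann_of_gen8_steps (hTS : TameSharpStep) (hT1 : TameSurplusOneStep)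
    (hWSH : WildSharpHyperplane) : SharpRelativeLindemann :=
  fun _ _ hr hIH _ => succ_le_polarDeg_of_gen8_steps hTS hT1 hWSH hr hIH

/-- T0 follows from the tame steps TSH ∧ TS1. -/
private theorem tameDefectZeroStep_of_tame_steps (hTS : TameSharpStep) (hT1 : TameSurplusOneStep) : TameDefectZeroStep :=
  fun m r hr hIH ht _ => tameKleinPolar_of_flag_steps hTS hT1 (m + 1) r hr hIH (isTame_of_lastTame hr ht)

/-- W0 ⟸ WSH pointwise: the inserted hypothesis is dropped. -/
private theorem wildSharpDefectZeroStep_of_wildSharpHyperplane (hWSH : WildSharpHyperplane) : WildSharpDefectZeroStep :=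
  fun m r hr hIH hW hS _ => hWSH m r hr hIH hW hS

/-- SRL ∧ T0 ∧ W0 ⟺ TSH ∧ TS1 ∧ WSH: round 9 is an EXACT re-factorisation of the gen-8 step pieces. -/
private theorem gen9_pieces_iff_gen8_steps :
    (SharpRelativeLindemann ∧ TameDefectZeroStep ∧ WildSharpDefectZeroStep) ↔
      (TameSharpStep ∧ TameSurplusOneStep ∧ WildSharpHyperplane) :=
  ⟨fun h => gen8_steps_of_floor h.1 h.2.1 h.2.2,
    fun h => ⟨sharpRelativeLindemann_of_gen8_steps h.1 h.2.1 h.2.2, tameDefectZeroStep_of_tame_steps h.1 h.2.1,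
      wildSharpDefectZeroStep_of_wildSharpHyperplane h.2.2⟩⟩

/-! ### Everything rounds 2–8 retired still follows -/

/-- C₁′ = `NoDefectTwoFirstFailure` (stmt-Schanuel-25469, aside) follows from the floor ALONE — its budget and side hypotheses
are not used. -/
theorem noDefectTwoFirstFailure_of_floor (hF : SharpRelativeLindemann) : NoDefectTwoFirstFailure :=
  fun _ _ hr hIH _ _ => pred_le_polarDeg_of_floor hF hr hIH

/-- Aut = `NoAutonomousSlackFirstFailure` (stmt-Schanuel-30166) from the four flag pieces of round 9 — the `--glue` of PATH R9
(`SharpRelativeLindemann → TameDefectZeroStep → WildSharpDefectZeroStep → NoWildAbsorbingSlackFirstFailure →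
NoAutonomousSlackFirstFailure`): tame tuples by the tame flag, wild sharp by WSH, wild absorbing slack = the residual
(the autonomy hypothesis is not used). -/
private theorem noAutonomousSlackFirstFailure_of_pieces9 (hF : SharpRelativeLindemann) (hT : TameDefectZeroStep)
    (hW : WildSharpDefectZeroStep) (hWAS : NoWildAbsorbingSlackFirstFailure) : NoAutonomousSlackFirstFailure :=
  noAutonomousSlackFirstFailure_of_pieces8 (tameSharpStep_of_floor hF hT) (tameSurplusOneStep_of_tameDefectZero hT)
    (wildSharpHyperplane_of_floor hF hW) hWAS

/-- The round-9 glue chain SRL → T0 → W0 → WAS → NoAutonomousSlackFirstFailure. -/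
theorem noAutonomousSlackFirstFailureGlue9_holds :
    SharpRelativeLindemann → TameDefectZeroStep → WildSharpDefectZeroStep → NoWildAbsorbingSlackFirstFailure →
      NoAutonomousSlackFirstFailure :=
  noAutonomousSlackFirstFailure_of_pieces9

/-- beneath the EQUIV layer: `LSB → Free → Tight → SRL → T0 → W0 → WAS → KleinPolarSchanuel` — the landed round-8 chain
`kleinPolarSchanuel_of_pieces8` fed with the derived gen-8 steps. -/
theorem kleinPolarSchanuel_of_pieces9 (hLSB : LocalSurplusBudget) (hFree : FreeSideCoupling) (hTight : TightBudgetCoupling)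
    (hF : SharpRelativeLindemann) (hT : TameDefectZeroStep) (hW : WildSharpDefectZeroStep)
    (hWAS : NoWildAbsorbingSlackFirstFailure) : KleinPolarSchanuel :=
  kleinPolarSchanuel_of_pieces8 hLSB hFree hTight (tameSharpStep_of_floor hF hT) (tameSurplusOneStep_of_tameDefectZero hT)
    (wildSharpHyperplane_of_floor hF hW) hWAS

end Summit.Schanuel.Schanuel.Theorems.RootDecomp1BDefectFloor
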